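import Literature.NumberTheory.LFunctions.TaoLogChowlaProofs
import Literature.NumberTheory.LFunctions.HalaszRestrictedOffMinimiser
import HarnessLib

/-!
# Twisted prime sums over the Vinogradov–Korobov window, and the region `𝒯₂` of the complex
# Matomäki–Radziwiłł theorem

Topic `Literature/NumberTheory/LFunctions`.  Everything in this file is PROVED (conditionally on the one
named fact passed as a hypothesis, Khale's explicit Vinogradov–Korobov zero-free region for Dirichlet
`L`-functions, `Khale2024_zeroFreeRegion`, exactly as in `TaoLogChowlaProofs.lean` and
`TwistedVonMangoldtSum.lean`); there are no new definitions and no named facts.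

Matomäki–Radziwiłł 2016, Lemma 2 reads: for real `f`, `1 ≤ |α| ≤ x^A`,
`𝔻(f, p^{iα}; x)² ≥ (1/12 - ε) log log x + O(1)`, and its proof rests on
"`∑_{exp((log x)^{2/3+ε}) ≤ p ≤ x} (1 - Re p^{-2iα})/p ≥ (1/3 - ε) log log x + O(1) - |∑ p^{-1-2iα}|
≥ (1/3 - ε) log log x + O(1)` by the zero-free region for the Riemann zeta-function".  The tree proves
Lemma 2 from Ford's bound `|ζ(1+it)| ≪ (log t)^{2/3}` (`PretentiousDistanceFord.lean`), which controls the
FULL distance `𝔻(1, n^{it}; x)²` but not its tail over `p > exp((log x)^{2/3+ε})`.  The tail is what the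
block-restricted sums of the complex Matomäki–Radziwiłł theorem need (Matomäki–Radziwiłł–Tao 2015,
Appendix A, Prop. A.3, region `𝒯₂`): by `Halasz.Restricted.halfDistSq_ge_quarter_tail_of_le_min`
(`HalaszRestrictedOffMinimiser.lean`) the halved distance of restricted Halász at `t` is at least a
quarter of the tail of `𝔻(1, n^{i(t-t₁)})²` beyond the blocks, `t₁` the minimiser of the full distance.
This file supplies the tail bound and the resulting `𝒯₂` estimate:

* `TwistedPrimeSumTail.norm_integral_weight_mul_cpow_le` — `‖∫_x^y u^{-it} du/(u log u)‖ ≤ 3` for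
  `|t| ≥ 1`, `log x ≥ 1` (integration by parts);
* `TwistedPrimeSumTail.norm_primeCharSum_le` — assume Khale's theorem; `A > 0`, `θ > 2/3`: for large
  `X`, `q ≤ (log X)^A`, `χ` mod `q`, `1 ≤ |t| ≤ X`, `Y ≤ X`:
  `‖∑_{exp((log X)^θ) ≤ p ≤ Y} χ(p)p^{-1-it}‖ ≤ 4` (the proof of
  `MRT2015DistLowerBound.re_primeCharSum_ge`, `TaoLogChowlaProofs.lean`, with the main term bounded in
  norm instead of in real part; for `|t| < 1` no such bound holds, the sum being `≈ log(1/(|t| (log X)^θ))`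
  near `t = 0`);
* `TwistedPrimeSumTail.sum_one_sub_re_twist_ge`, `…pretentiousDistSq_one_twist_tail_ge` — with Mertens'
  theorem (`MertensBound.loglog_sub_loglog_le_sum_inv_prime_Icc`):
  `∑_{exp((log X)^θ) ≤ p ≤ Y} (1 - Re p^{it})/p ≥ log log Y - θ log log X - 6`, i.e.
  `𝔻(1, n^{it}; Y)² - 𝔻(1, n^{it}; exp((log X)^θ) - 1)² ≥ log log Y - θ log log X - 6`
  (`1 ≤ |t| ≤ X`, `exp((log X)^θ) ≤ Y ≤ X`) — MR's Lemma 2 localised, for twists;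
* `TwistedPrimeSumTail.halfDistSq_ge_of_far_from_minimiser` (and `…_two_mul`, scale `2x`) — **the
  region `𝒯₂` for restricted sums**: for `|g| ≤ 1`, blocks below `exp((log X)^θ) - 1`,
  `exp((log X)^θ) ≤ x ≤ X`, `t₁` a `δ`-near-minimiser of `min_{|u| ≤ T} 𝔻(g, n^{iu}; x)²`, `|t| ≤ T` and
  `1 ≤ |t - t₁| ≤ X`:  `𝔻_½(g, n^{it}; x)² ≥ (log log x - θ log log X - 6)/4 - δ/2`, i.e.
  `≥ (1/12 - ε) log log x - O(1)` with `θ = 2/3 + ε`, `X = 2x` — the constant of the unrestricted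
  argument, with no loss from the restriction and no `2^J` from inclusion–exclusion.

## References
* K. Matomäki, M. Radziwiłł, *Multiplicative functions in short intervals*, Ann. of Math. 183 (2016),
  Lemma 2 and its proof. [cite: MatomakiRadziwillAnnals2016, Lemma 2]
* K. Matomäki, M. Radziwiłł, T. Tao, *An averaged form of Chowla's conjecture*, Algebra & Number Theory
  9 (2015), Appendix A, proof of Proposition A.3 (`2𝔻(f, p^{it}) ≥ 𝔻(1, p^{i(t-t₁)}) ≥ (1/√3 - ε)√(log log X)`).
  [cite: MatomakiRadziwillTao2015, Appendix A, Proposition A.3 (proof)]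
* T. Khale, Q. J. Math. 75 (2024), 299–332, Theorem 1.1. [cite: Khale2024, Theorem 1.1]

## Remark on the regions `𝒯₀ ∪ 𝒯₁` of Proposition A.3 (not treated here)
Near the minimiser the printed proof uses "`F(1+it) ≪ exp(-M(f;X)) M(f;X)` coming from Halász's theorem
for `t ∈ 𝒯₀ = {|t - t₁| ≤ e^M/M}`".  For the block-RESTRICTED `F` this pointwise bound fails (one block
`E`, `f = -1` on `E` and `1` elsewhere, `t₁ = 0`: `M = 2K`, `K = ∑_{p ∈ E} 1/p`, while
`f 1_𝒮 = f - 1_{(n,E)=1}` has mean `≍ -e^{-K} = -e^{-M/2}`), and `norm_restr_sum_le` gives exactly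
`(1 + M/2) e^{-M/2}` uniformly; splitting `{|t - t₁| ≤ S} ∪ {|t - t₁| > S}` with the decay `2/|t - t₁|`
of the `1/T`-term then bounds `∫_{𝒯₀ ∪ 𝒯₁} |F|²` by `≍ (1 + M) e^{-M/2}`, not by the vendored middle term
`(1 + M) e^{-M}` of `MatomakiRadziwillTao2015_propA3` (which the example does not contradict: there
`|F(1+it)| ≍ e^{-M/2}/(1 + |t|)` and `∫ |F|² ≍ e^{-M}`).  Downstream, Theorem A.2 is consumed only in
`MRT2015.winL1_typical_le` (`MatomakiRadziwillTaoMajorArc.lean`), for COMPLETELY multiplicative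
functions and at `M_low = 3 log W - 48`, through `√((1 + M_low) e^{-M_low}) ≤ 3e^{24} W^{-5/4}`; a middle
term `(1 + M)^k e^{-M}` would serve equally, a middle term `(1 + M) e^{-M/2}` would require
`M_low ≥ 5 log W + O(1)`, i.e. the hypothesis `W ≤ exp(M/6)` in place of Matomäki–Radziwiłł–Tao's
`W ≤ exp(M/3)` in Theorem 2.3 / Proposition 2.4, and `log H₀ = e^{M/40} M` (giving `e^{-M/40}`) in the
deduction of Theorem 1.7.

## Design choices
* Every Khale-dependent theorem is proved in the form `…_of_vk (hcVK : 0 < cVK) (hVK : HasVKZeroFreeRegion cVK TVK)`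
  (any Vinogradov–Korobov region, `TwistedVonMangoldt.twisted_sum_estimate_of_vk`), the Khale form being its
  specialisation through `hasVKZeroFreeRegion_of_khale`.
* The scale `X` (where the twisted prime number theorem `TwistedVonMangoldt.twisted_sum_estimate` is
  invoked, `|t| ≤ X`) is kept separate from the upper summation limit `Y ≤ X` and from `x` in the `𝒯₂`
  bound; users needing `|t - t₁| ≤ 2x` take `X = 2x` (`…_two_mul`).
* Thresholds are existential (`∀ᶠ X in atTop`), constants explicit and not optimised.
-/

noncomputable section

open MeasureTheory Set intervalIntegral Complex Filter Topology

namespace Literature.NumberTheory.LFunctions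

namespace TwistedPrimeSumTail

open Literature.NumberTheory.Sieve.Lichtman2020.PrimeCharSum TwistedVonMangoldt MRT2015DistLowerBound

/-- `‖u^{s}‖ = 1` for `u > 0` real and `s` purely imaginary. [folklore] -/
theorem norm_ofReal_cpow_of_re_eq_zero {u : ℝ} (hu : 0 < u) {s : ℂ} (hs : s.re = 0) :
    ‖(u : ℂ) ^ s‖ = 1 := by
  rw [Complex.norm_cpow_eq_rpow_re_of_pos hu, hs, Real.rpow_zero]

/-- `∫_x^y du/(u log² u) = 1/log x − 1/log y` for `1 < x ≤ y`. [folklore] -/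
theorem integral_inv_mul_log_sq {x y : ℝ} (hx : 1 < x) (hxy : x ≤ y) :
    ∫ u in x..y, u⁻¹ / Real.log u ^ 2 = (Real.log x)⁻¹ - (Real.log y)⁻¹ := by
  have hmem : ∀ u ∈ uIcc x y, 1 < u := fun u hu => by
    rw [uIcc_of_le hxy] at hu; exact hx.trans_le hu.1
  have hderiv : ∀ u ∈ uIcc x y, HasDerivAt (fun u : ℝ => -(Real.log u)⁻¹) (u⁻¹ / Real.log u ^ 2) u := by
    intro u hu
    have hu1 := hmem u hu
    have hu0 : u ≠ 0 := by linarith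
    have hlog : Real.log u ≠ 0 := (Real.log_pos hu1).ne'
    have h1 : HasDerivAt (fun v : ℝ => (Real.log v)⁻¹) (-(u⁻¹) / Real.log u ^ 2) u :=
      (Real.hasDerivAt_log hu0).inv hlog
    have h2 : HasDerivAt (fun v : ℝ => -(Real.log v)⁻¹) (-(-(u⁻¹) / Real.log u ^ 2)) u := h1.neg
    exact h2.congr_deriv (by ring)
  have hcont : ContinuousOn (fun u : ℝ => u⁻¹ / Real.log u ^ 2) (uIcc x y) := by
    refine ContinuousOn.div (continuousOn_inv₀.mono fun u hu => ?_)
      ((Real.continuousOn_log.mono fun u hu => ?_).pow 2) fun u hu => ?_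
    · simp only [mem_compl_iff, mem_singleton_iff]; linarith [hmem u hu]
    · simp only [mem_compl_iff, mem_singleton_iff]; linarith [hmem u hu]
    · exact pow_ne_zero 2 (Real.log_pos (hmem u hu)).ne'
  rw [intervalIntegral.integral_eq_sub_of_hasDerivAt hderiv hcont.intervalIntegrable]
  ring

/-- **The main term is bounded for `|t| ≥ 1`**: for `log x ≥ 1`, `x ≤ y` and `1 ≤ |t|`,
`‖∫_x^y u^{-it}/(u log u) du‖ ≤ 3`.  Integration by parts:
`∫_x^y (1/log u) d(u^{-it}/(-it)) = [u^{-it}/(-it log u)]_x^y - ∫_x^y u^{-it}/(it u log² u) du`, and each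
of the three terms has norm `≤ 1/|t| ≤ 1`. [folklore] -/
theorem norm_integral_weight_mul_cpow_le {t : ℝ} (ht : 1 ≤ |t|) {x y : ℝ} (hx : Real.exp 1 ≤ x)
    (hxy : x ≤ y) :
    ‖∫ u in x..y, ((weight u : ℝ) : ℂ) * (u : ℂ) ^ (-((t : ℂ) * I))‖ ≤ 3 := by
  have hx1 : 1 < x := lt_of_lt_of_le (by have := Real.add_one_le_exp (1 : ℝ); linarith) hx
  have hx0 : 0 < x := by linarith
  have hmem : ∀ u ∈ uIcc x y, x ≤ u := fun u hu => by
    rw [uIcc_of_le hxy] at hu; exact hu.1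
  have hlogx : 1 ≤ Real.log x := by
    rw [← Real.log_exp 1]; exact Real.log_le_log (Real.exp_pos 1) hx
  have ht0 : 0 < |t| := lt_of_lt_of_le one_pos ht
  have htne : t ≠ 0 := abs_pos.1 ht0
  -- exponents
  set r : ℂ := -((t : ℂ) * I) with hrdef
  have hr_re : r.re = 0 := by simp [hrdef]
  have hr0 : r ≠ 0 := by
    intro h
    have := congrArg Complex.im h
    simp [hrdef] at this
    exact htne this
  have hnorm_r : ‖r‖ = |t| := by
    rw [hrdef, norm_neg, norm_mul, Complex.norm_I, mul_one, Complex.norm_real, Real.norm_eq_abs]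
  set r' : ℂ := r - 1 with hr'def
  have hr'1 : r' + 1 = r := by rw [hr'def]; ring
  have hr'ne : r' ≠ -1 := by
    intro h
    apply hr0
    rw [← hr'1, h]; ring
  -- `G(u) = u^r / r`, `G' = u^{r-1}`
  set G : ℝ → ℂ := fun u => (u : ℂ) ^ (r' + 1) / (r' + 1) with hGdef
  have hGderiv : ∀ u ∈ uIcc x y, HasDerivAt G ((u : ℂ) ^ r') u := fun u hu =>
    hasDerivAt_ofReal_cpow_const' (by linarith [hmem u hu]) hr'ne
  have hGnorm : ∀ u : ℝ, 0 < u → ‖G u‖ = 1 / |t| := by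
    intro u hu
    rw [hGdef]; dsimp only
    rw [hr'1, norm_div, norm_ofReal_cpow_of_re_eq_zero hu hr_re, hnorm_r]
  -- `F(u) = 1/log u`, `F' = -u⁻¹/log² u`
  set F : ℝ → ℂ := fun u => (((Real.log u)⁻¹ : ℝ) : ℂ) with hFdef
  set F' : ℝ → ℂ := fun u => ((-(u⁻¹) / Real.log u ^ 2 : ℝ) : ℂ) with hF'def
  have hFderiv : ∀ u ∈ uIcc x y, HasDerivAt F (F' u) u := by
    intro u hu
    have hu1 : 1 < u := hx1.trans_le (hmem u hu)
    have hu0 : u ≠ 0 := by linarith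
    have hlog : Real.log u ≠ 0 := (Real.log_pos hu1).ne'
    have h1 : HasDerivAt (fun v : ℝ => (Real.log v)⁻¹) (-(u⁻¹) / Real.log u ^ 2) u :=
      (Real.hasDerivAt_log hu0).inv hlog
    have h2 : HasDerivAt (fun v : ℝ => (((Real.log v)⁻¹ : ℝ) : ℂ)) (((-(u⁻¹) / Real.log u ^ 2 : ℝ) : ℂ)) u :=
      h1.ofReal_comp
    rw [hFdef, hF'def]
    exact h2
  -- continuity / integrability
  have hlogc : ContinuousOn Real.log (uIcc x y) := Real.continuousOn_log.mono fun u hu => by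
    simp only [mem_compl_iff, mem_singleton_iff]; linarith [hmem u hu]
  have hF'contR : ContinuousOn (fun u : ℝ => -(u⁻¹) / Real.log u ^ 2) (uIcc x y) := by
    refine ContinuousOn.div (continuousOn_inv₀.mono fun u hu => ?_).neg (hlogc.pow 2) fun u hu => ?_
    · simp only [mem_compl_iff, mem_singleton_iff]; linarith [hmem u hu]
    · exact pow_ne_zero 2 (Real.log_pos (hx1.trans_le (hmem u hu))).ne'
  have hF'cont : ContinuousOn F' (uIcc x y) := Complex.continuous_ofReal.comp_continuousOn hF'contR
  have hG'cont : ContinuousOn (fun u : ℝ => (u : ℂ) ^ r') (uIcc x y) :=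
    continuousOn_ofReal_cpow_const hx0 hxy r'
  have hGcont : ContinuousOn G (uIcc x y) :=
    (continuousOn_ofReal_cpow_const hx0 hxy (r' + 1)).div_const _
  have hF'_int : IntervalIntegrable F' volume x y := hF'cont.intervalIntegrable
  have hG'_int : IntervalIntegrable (fun u : ℝ => (u : ℂ) ^ r') volume x y := hG'cont.intervalIntegrable
  -- the integrand is `F · G'`
  have hinteg : ∫ u in x..y, ((weight u : ℝ) : ℂ) * (u : ℂ) ^ (-((t : ℂ) * I)) =
      ∫ u in x..y, F u * (u : ℂ) ^ r' := by
    refine intervalIntegral.integral_congr fun u hu => ?_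
    have hu0 : 0 < u := hx0.trans_le (hmem u hu)
    have hu1 : 1 < u := hx1.trans_le (hmem u hu)
    have huC : (u : ℂ) ≠ 0 := Complex.ofReal_ne_zero.2 hu0.ne'
    have hlog : Real.log u ≠ 0 := (Real.log_pos hu1).ne'
    have hlogC : ((Real.log u : ℝ) : ℂ) ≠ 0 := Complex.ofReal_ne_zero.2 hlog
    rw [hFdef]; dsimp only
    rw [← hrdef, hr'def, Complex.cpow_sub _ _ huC, Complex.cpow_one, weight]
    push_cast
    field_simp
  -- integration by parts
  have hIBP : ∫ u in x..y, F u * (u : ℂ) ^ r' = F y * G y - F x * G x - ∫ u in x..y, F' u * G u :=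
    intervalIntegral.integral_mul_deriv_eq_deriv_mul hFderiv hGderiv hF'_int hG'_int
  -- the three bounds
  have hy0 : 0 < y := hx0.trans_le hxy
  have hlogy : 1 ≤ Real.log y := hlogx.trans (Real.log_le_log hx0 hxy)
  have hFnorm : ∀ u : ℝ, x ≤ u → ‖F u‖ ≤ 1 := by
    intro u hu
    have hlogu : 1 ≤ Real.log u := hlogx.trans (Real.log_le_log hx0 hu)
    rw [hFdef]; dsimp only
    rw [Complex.norm_real, Real.norm_eq_abs, abs_of_pos (by positivity)]
    exact inv_le_one_of_one_le₀ hlogu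
  have hinvt : 1 / |t| ≤ 1 := by rw [div_le_one ht0]; exact ht
  have h1 : ‖F y * G y‖ ≤ 1 := by
    rw [norm_mul, hGnorm y hy0]
    calc ‖F y‖ * (1 / |t|) ≤ 1 * 1 := mul_le_mul (hFnorm y hxy) hinvt (by positivity) zero_le_one
      _ = 1 := one_mul 1
  have h2 : ‖F x * G x‖ ≤ 1 := by
    rw [norm_mul, hGnorm x hx0]
    calc ‖F x‖ * (1 / |t|) ≤ 1 * 1 := mul_le_mul (hFnorm x le_rfl) hinvt (by positivity) zero_le_one
      _ = 1 := one_mul 1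
  have h3 : ‖∫ u in x..y, F' u * G u‖ ≤ 1 := by
    have hbound : ∀ᵐ u : ℝ ∂volume, u ∈ Set.Ioc x y → ‖F' u * G u‖ ≤ 1 / |t| * (u⁻¹ / Real.log u ^ 2) := by
      refine ae_of_all _ fun u hu => ?_
      have hu0 : 0 < u := hx0.trans hu.1
      have hu1 : 1 < u := hx1.trans hu.1
      rw [norm_mul, hGnorm u hu0, hF'def]; dsimp only
      rw [Complex.norm_real, Real.norm_eq_abs, abs_div, abs_neg, abs_of_pos (inv_pos.2 hu0),
        abs_of_pos (pow_pos (Real.log_pos hu1) 2)]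
      linarith
    have hgi : IntervalIntegrable (fun u : ℝ => 1 / |t| * (u⁻¹ / Real.log u ^ 2)) volume x y := by
      refine (ContinuousOn.intervalIntegrable ?_)
      refine continuousOn_const.mul (ContinuousOn.div (continuousOn_inv₀.mono fun u hu => ?_)
        (hlogc.pow 2) fun u hu => ?_)
      · simp only [mem_compl_iff, mem_singleton_iff]; linarith [hmem u hu]
      · exact pow_ne_zero 2 (Real.log_pos (hx1.trans_le (hmem u hu))).ne'
    refine (intervalIntegral.norm_integral_le_of_norm_le hxy hbound hgi).trans ?_
    rw [intervalIntegral.integral_const_mul, integral_inv_mul_log_sq hx1 hxy]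
    have hlx : (Real.log x)⁻¹ ≤ 1 := inv_le_one_of_one_le₀ hlogx
    have hly : 0 ≤ (Real.log y)⁻¹ := by positivity
    calc 1 / |t| * ((Real.log x)⁻¹ - (Real.log y)⁻¹) ≤ 1 * 1 :=
          mul_le_mul hinvt (by linarith) (by
            have := Real.log_le_log hx0 hxy
            have h' : (Real.log y)⁻¹ ≤ (Real.log x)⁻¹ := by
              apply inv_anti₀ (by linarith) this
            linarith) zero_le_one
      _ = 1 := one_mul 1
  rw [hinteg, hIBP]
  calc ‖F y * G y - F x * G x - ∫ u in x..y, F' u * G u‖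
      ≤ ‖F y * G y - F x * G x‖ + ‖∫ u in x..y, F' u * G u‖ := norm_sub_le _ _
    _ ≤ (‖F y * G y‖ + ‖F x * G x‖) + ‖∫ u in x..y, F' u * G u‖ := by
        gcongr; exact norm_sub_le _ _
    _ ≤ (1 + 1) + 1 := add_le_add (add_le_add h1 h2) h3
    _ = 3 := by norm_num

set_option maxHeartbeats 1600000 in
/-- (From any Vinogradov–Korobov region `HasVKZeroFreeRegion cVK TVK`, `cVK > 0`.)  **The prime character sums over the Vinogradov–Korobov window are bounded, for `|t| ≥ 1`.**
Assume Khale's theorem.  For `A > 0`, `θ > 2/3`: for all large `X`, all `q ≤ (log X)^A`, all `χ` mod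
`q`, all `1 ≤ |t| ≤ X` and all `Y ≤ X`,
`‖∑_{exp((log X)^θ) ≤ p ≤ Y} χ(p) p^{-1-it}‖ ≤ 4`.
This is the quantitative content of "by the zero-free region for the Riemann zeta-function,
`|∑_{exp((log x)^{2/3+ε}) ≤ p ≤ x} p^{-1-2iα}| = O(1)` for `1 ≤ |α| ≤ x^A`" in the proof of
Matomäki–Radziwiłł 2016, Lemma 2 (here for `|t| ≤ X`, with characters, and uniformly in the upper
limit `Y ≤ X`).  Proof: word for word that of `MRT2015DistLowerBound.re_primeCharSum_ge` (Abel summation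
with `f(u) = 1/(u log u)` against `D(u) = ∑_{p ≤ u} χ(p) log p · p^{-it} = δ_χ u^{1-it}/(1-it) + O(u(log X)^{-2})`,
`TwistedVonMangoldt.twisted_sum_estimate`, error terms `≤ 1` in norm), except that the main term
`δ_χ ∫ u^{-it} du/(u log u)` is now bounded in norm by `3` for `|t| ≥ 1`
(`norm_integral_weight_mul_cpow_le`) instead of in real part from below.
[cite: MatomakiRadziwillAnnals2016, Lemma 2 (proof)] [cite: Khale2024, Theorem 1.1] -/
theorem norm_primeCharSum_le_of_vk {cVK TVK : ℝ} (hcVK : 0 < cVK) (hVK : HasVKZeroFreeRegion cVK TVK) {A θ : ℝ} (hA : 0 < A)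
    (hθ : 2 / 3 < θ) :
    ∀ᶠ X : ℝ in atTop, ∀ (q : ℕ) [NeZero q], (q : ℝ) ≤ Real.log X ^ A →
      ∀ (χ : DirichletCharacter ℂ q) (t : ℝ), 1 ≤ |t| → |t| ≤ X → ∀ Y : ℝ, Y ≤ X →
        ‖∑ p ∈ (Finset.Icc ⌈Real.exp (Real.log X ^ θ)⌉₊ ⌊Y⌋₊).filter Nat.Prime,
            χ (p : ZMod q) * (p : ℂ) ^ (-(1 + (t : ℂ) * I))‖ ≤ 4 := by
  have hθ0 : 0 < θ := by linarith
  filter_upwards [twisted_sum_estimate_of_vk hcVK hVK hA hθ (K := 2) (by norm_num),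
    Real.tendsto_log_atTop.eventually_ge_atTop (16 : ℝ),
    ((tendsto_rpow_atTop hθ0).comp Real.tendsto_log_atTop).eventually_ge_atTop (4 : ℝ),
    eventually_mul_log_rpow_le_exp 16 2 (show (0 : ℝ) < 1 / 4 by norm_num) hθ0,
    eventually_gt_atTop (0 : ℝ)] with X htw hℓ16 hℓθ hEψ hX0
  intro q _ hqA χ t ht1 ht Y hYX
  set ℓ : ℝ := Real.log X with hℓdef
  have hℓ1 : 1 ≤ ℓ := by linarith
  have hℓ0 : 0 < ℓ := by linarith
  have hℓθ' : (4 : ℝ) ≤ ℓ ^ θ := by simpa using hℓθ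
  set P : ℝ := Real.exp (ℓ ^ θ) with hPdef
  have hP0 : 0 < P := Real.exp_pos _
  -- the empty range
  rcases lt_or_ge Y P with hYP | hPY
  · have hempty : (Finset.Icc ⌈P⌉₊ ⌊Y⌋₊).filter Nat.Prime = ∅ := by
      have hlt : ⌊Y⌋₊ < ⌈P⌉₊ := by
        rcases le_or_gt 0 Y with hY0 | hY0
        · have h1 : (⌊Y⌋₊ : ℝ) ≤ Y := Nat.floor_le hY0
          have h2 : P ≤ ⌈P⌉₊ := Nat.le_ceil P
          exact_mod_cast (show (⌊Y⌋₊ : ℝ) < ⌈P⌉₊ by linarith)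
        · rw [Nat.floor_of_nonpos hY0.le]
          exact Nat.ceil_pos.2 hP0
      rw [Finset.Icc_eq_empty_of_lt hlt, Finset.filter_empty]
    rw [hempty, Finset.sum_empty, norm_zero]
    norm_num
  have hY0 : 0 ≤ Y := hP0.le.trans hPY
  -- parameters
  set ε : ℝ := ℓ ^ (-(2 : ℝ)) with hεdef
  have hε0 : 0 < ε := Real.rpow_pos_of_pos hℓ0 _
  have hεval : ε = (ℓ ^ 2)⁻¹ := by
    rw [hεdef, Real.rpow_neg hℓ0.le, Real.rpow_two]
  have hεψ : 16 * Real.exp (-(ℓ ^ θ / 4)) ≤ ε := by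
    have hprod : ℓ ^ (2 : ℝ) * ε = 1 := by
      rw [hεdef, ← Real.rpow_add hℓ0, add_neg_cancel, Real.rpow_zero]
    have h1 := mul_le_mul_of_nonneg_right hEψ (show 0 ≤ Real.exp (-(ℓ ^ θ / 4)) * ε by positivity)
    have h2 : 16 * ℓ ^ (2 : ℝ) * (Real.exp (-(ℓ ^ θ / 4)) * ε) =
        16 * Real.exp (-(ℓ ^ θ / 4)) * (ℓ ^ (2 : ℝ) * ε) := by ring
    have h3 : Real.exp (1 / 4 * ℓ ^ θ) * (Real.exp (-(ℓ ^ θ / 4)) * ε) = ε := by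
      rw [← mul_assoc, ← Real.exp_add, show 1 / 4 * ℓ ^ θ + -(ℓ ^ θ / 4) = 0 by ring, Real.exp_zero,
        one_mul]
    rw [h2, hprod, mul_one, h3] at h1
    exact h1
  -- `P`, `n`, `m`
  have he4 : (5 : ℝ) ≤ Real.exp 4 := by have := Real.add_one_le_exp (4 : ℝ); linarith
  have hexpP : Real.exp 4 ≤ P := Real.exp_le_exp.2 hℓθ'
  have hP5 : 5 ≤ P := he4.trans hexpP
  rw [sum_primes_eq_sum_weight_mul χ t hP0 Y]
  set n : ℕ := ⌈P⌉₊ - 1 with hndef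
  set m : ℕ := ⌊Y⌋₊ with hmdef
  have hn1 : 1 ≤ ⌈P⌉₊ := Nat.ceil_pos.2 hP0
  have hncast : (n : ℝ) = ⌈P⌉₊ - 1 := by rw [hndef, Nat.cast_sub hn1, Nat.cast_one]
  have hnP : P - 1 ≤ n := by rw [hncast]; linarith [Nat.le_ceil P]
  have hn_ge : Real.exp (ℓ ^ θ) / 2 ≤ n := by rw [← hPdef]; linarith
  have hn2 : (2 : ℝ) ≤ n := by linarith
  have hn0 : (0 : ℝ) < n := by linarith
  have hn1' : (1 : ℝ) < n := by linarith
  have hmX : (m : ℝ) ≤ X := (Nat.floor_le hY0).trans hYX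
  have hnm : n ≤ m := by
    have h1 : (⌈P⌉₊ : ℝ) < P + 1 := Nat.ceil_lt_add_one hP0.le
    have h2 : Y < (⌊Y⌋₊ : ℝ) + 1 := Nat.lt_floor_add_one Y
    have h3 : (⌈P⌉₊ : ℝ) < (⌊Y⌋₊ : ℝ) + 2 := by linarith
    have h4 : ⌈P⌉₊ < ⌊Y⌋₊ + 2 := by exact_mod_cast h3
    omega
  have hnmR : (n : ℝ) ≤ m := by exact_mod_cast hnm
  have hm0 : (0 : ℝ) < m := by linarith
  -- logarithms
  have hlog2 : Real.log 2 ≤ 1 := by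
    have := Real.log_le_sub_one_of_pos (show (0 : ℝ) < 2 by norm_num); linarith
  have hlogn : ℓ ^ θ / 2 ≤ Real.log n := by
    have h1 : Real.log (Real.exp (ℓ ^ θ) / 2) = ℓ ^ θ - Real.log 2 := by
      rw [Real.log_div (Real.exp_pos _).ne' (by norm_num), Real.log_exp]
    have h2 : Real.log (Real.exp (ℓ ^ θ) / 2) ≤ Real.log n := Real.log_le_log (by positivity) hn_ge
    linarith
  have hlogn1 : 1 ≤ Real.log n := by linarith
  have hlogn0 : 0 < Real.log n := by linarith
  have hlogm : Real.log n ≤ Real.log m := Real.log_le_log hn0 hnmR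
  have hlogm0 : 0 < Real.log m := by linarith
  have hlogmn : Real.log ((m : ℝ) / n) ≤ ℓ := by
    have h1 : (m : ℝ) / n ≤ X := by
      rw [div_le_iff₀ hn0]
      calc (m : ℝ) ≤ X := hmX
        _ = X * 1 := (mul_one X).symm
        _ ≤ X * n := mul_le_mul_of_nonneg_left hn1'.le hX0.le
    exact Real.log_le_log (by positivity) h1
  -- the main term `M(u) = δ u^{r+1}/(r+1)`, `r = -it`, and its derivative `M'(u) = δ u^r`
  set r : ℂ := -((t : ℂ) * I) with hrdef
  have hr1 : r + 1 = 1 - t * I := by rw [hrdef]; ring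
  have hrne : r ≠ -1 := by
    intro h
    have := congrArg Complex.re h
    simp [hrdef] at this
  set M : ℝ → ℂ := fun u => delta χ * ((u : ℂ) ^ (r + 1) / (r + 1)) with hMdef
  set M' : ℝ → ℂ := fun u => delta χ * (u : ℂ) ^ r with hM'def
  have hMderiv : ∀ u ∈ uIcc (n : ℝ) m, HasDerivAt M (M' u) u := by
    intro u hu
    rw [uIcc_of_le hnmR] at hu
    have hu0 : u ≠ 0 := by linarith [hu.1]
    exact (hasDerivAt_ofReal_cpow_const' hu0 hrne).const_mul (delta χ)
  have hMeq : ∀ u : ℝ, M u = delta χ * (u : ℂ) ^ (1 - t * I) / (1 - t * I) := by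
    intro u
    simp only [hMdef, hr1, mul_div_assoc]
  -- `‖D(u) − M(u)‖ ≤ 2εu` on `[n, m]`
  have hDM : ∀ u : ℝ, (n : ℝ) ≤ u → u ≤ m →
      ‖∑ k ∈ Finset.Icc 0 ⌊u⌋₊, primeCoeff χ t k - M u‖ ≤ 2 * ε * u := by
    intro u hu1 hu2
    have hulo : Real.exp (ℓ ^ θ) / 2 ≤ u := hn_ge.trans hu1
    have huX : u ≤ X := hu2.trans hmX
    rw [hMeq]
    exact norm_sum_primeCoeff_sub_le χ t (htw q hqA χ t ht u hulo huX)
      (psi_sub_theta_le_of_scale hℓθ' hεψ hulo)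
  -- Abel summation
  have hf_diff : ∀ u ∈ Set.Icc (n : ℝ) m, DifferentiableAt ℝ (fun u : ℝ ↦ ((weight u : ℝ) : ℂ)) u :=
    fun u hu ↦ (hasDerivAt_weightC (by linarith [hu.1] : 1 < u)).differentiableAt
  have hderiv : ∀ u ∈ Set.Icc (n : ℝ) m, deriv (fun u : ℝ ↦ ((weight u : ℝ) : ℂ)) u =
      (((-(Real.log u + 1) / (u * Real.log u) ^ 2 : ℝ)) : ℂ) :=
    fun u hu ↦ (hasDerivAt_weightC (by linarith [hu.1] : 1 < u)).deriv
  have hcontR : ContinuousOn (fun u : ℝ ↦ -(Real.log u + 1) / (u * Real.log u) ^ 2) (Set.Icc (n : ℝ) m) := by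
    have hlogc : ContinuousOn Real.log (Set.Icc (n : ℝ) m) :=
      Real.continuousOn_log.mono fun u hu ↦ by
        simp only [Set.mem_compl_iff, Set.mem_singleton_iff]
        exact (by linarith [hu.1] : (0 : ℝ) < u).ne'
    refine ContinuousOn.div ((hlogc.add continuousOn_const).neg) ((continuousOn_id.mul hlogc).pow 2) ?_
    intro u hu
    have hu1 : 1 < u := by linarith [hu.1]
    exact pow_ne_zero 2 (mul_ne_zero (by linarith) (Real.log_pos hu1).ne')
  have hcontC : ContinuousOn (fun u : ℝ ↦ (((-(Real.log u + 1) / (u * Real.log u) ^ 2 : ℝ)) : ℂ))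
      (Set.Icc (n : ℝ) m) := Complex.continuous_ofReal.comp_continuousOn hcontR
  have hf_int : IntegrableOn (deriv (fun u : ℝ ↦ ((weight u : ℝ) : ℂ))) (Set.Icc (n : ℝ) m) :=
    (hcontC.integrableOn_Icc).congr_fun (fun u hu ↦ (hderiv u hu).symm) measurableSet_Icc
  have hAbel : ∑ k ∈ Finset.Ioc n m, ((weight k : ℝ) : ℂ) * primeCoeff χ t k =
      ((weight m : ℝ) : ℂ) * (∑ k ∈ Finset.Icc 0 m, primeCoeff χ t k) -
        ((weight n : ℝ) : ℂ) * (∑ k ∈ Finset.Icc 0 n, primeCoeff χ t k) -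
        ∫ u in Set.Ioc (n : ℝ) m, deriv (fun u : ℝ ↦ ((weight u : ℝ) : ℂ)) u *
          ∑ k ∈ Finset.Icc 0 ⌊u⌋₊, primeCoeff χ t k :=
    sum_mul_eq_sub_sub_integral_mul' (primeCoeff χ t) hnm hf_diff hf_int
  -- the Abel integral as an interval integral of `w' · D`
  set w' : ℝ → ℂ := fun u ↦ (((-(Real.log u + 1) / (u * Real.log u) ^ 2 : ℝ)) : ℂ) with hw'def
  set D : ℝ → ℂ := fun u ↦ ∑ k ∈ Finset.Icc 0 ⌊u⌋₊, primeCoeff χ t k with hDdef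
  have hIoc : ∫ u in Set.Ioc (n : ℝ) m, deriv (fun u : ℝ ↦ ((weight u : ℝ) : ℂ)) u *
      ∑ k ∈ Finset.Icc 0 ⌊u⌋₊, primeCoeff χ t k = ∫ u in (n : ℝ)..m, w' u * D u := by
    rw [intervalIntegral.integral_of_le hnmR]
    refine setIntegral_congr_fun measurableSet_Ioc fun u hu => ?_
    simp only [hw'def, hDdef]
    rw [hderiv u ⟨hu.1.le, hu.2⟩]
  -- integrability of `w' · D` and `w' · M`, `M'`
  have hwD_int : IntervalIntegrable (fun u => w' u * D u) volume n m := by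
    rw [intervalIntegrable_iff_integrableOn_Icc_of_le hnmR]
    exact integrableOn_mul_sum_Icc (primeCoeff χ t) (Nat.cast_nonneg n) hcontC.integrableOn_Icc
  have hMcont : ContinuousOn M (uIcc (n : ℝ) m) :=
    continuousOn_const.mul ((continuousOn_ofReal_cpow_const hn0 hnmR (r + 1)).div_const (r + 1))
  have hM'cont : ContinuousOn M' (uIcc (n : ℝ) m) :=
    continuousOn_const.mul (continuousOn_ofReal_cpow_const hn0 hnmR r)
  have hw'cont : ContinuousOn w' (uIcc (n : ℝ) m) := by rw [uIcc_of_le hnmR]; exact hcontC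
  have hwM_int : IntervalIntegrable (fun u => w' u * M u) volume n m :=
    (hw'cont.mul hMcont).intervalIntegrable
  have hw'_int : IntervalIntegrable w' volume n m := hw'cont.intervalIntegrable
  have hM'_int : IntervalIntegrable M' volume n m := hM'cont.intervalIntegrable
  -- integration by parts for the main term
  have hwderiv : ∀ u ∈ uIcc (n : ℝ) m, HasDerivAt (fun u : ℝ ↦ ((weight u : ℝ) : ℂ)) (w' u) u := by
    intro u hu
    rw [uIcc_of_le hnmR] at hu
    exact hasDerivAt_weightC (by linarith [hu.1] : 1 < u)
  have hIBP : ∫ u in (n : ℝ)..m, ((weight u : ℝ) : ℂ) * M' u =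
      ((weight m : ℝ) : ℂ) * M m - ((weight n : ℝ) : ℂ) * M n -
        ∫ u in (n : ℝ)..m, w' u * M u :=
    intervalIntegral.integral_mul_deriv_eq_deriv_mul hwderiv hMderiv hw'_int hM'_int
  -- the decomposition `S = Main + Err`
  set Main : ℂ := ∫ u in (n : ℝ)..m, ((weight u : ℝ) : ℂ) * M' u with hMain
  set Err : ℂ := ((weight m : ℝ) : ℂ) * (D m - M m) - ((weight n : ℝ) : ℂ) * (D n - M n) -
      ∫ u in (n : ℝ)..m, w' u * (D u - M u) with hErr
  have hsub_int : ∫ u in (n : ℝ)..m, w' u * (D u - M u) =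
      (∫ u in (n : ℝ)..m, w' u * D u) - ∫ u in (n : ℝ)..m, w' u * M u := by
    rw [← intervalIntegral.integral_sub hwD_int hwM_int]
    refine intervalIntegral.integral_congr fun u _ => ?_
    simp only [mul_sub]
  have hDm : D m = ∑ k ∈ Finset.Icc 0 m, primeCoeff χ t k := by
    simp only [hDdef, Nat.floor_natCast]
  have hDn : D n = ∑ k ∈ Finset.Icc 0 n, primeCoeff χ t k := by
    simp only [hDdef, Nat.floor_natCast]
  have hdecomp : ∑ k ∈ Finset.Ioc n m, ((weight k : ℝ) : ℂ) * primeCoeff χ t k = Main + Err := by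
    rw [hAbel, hIoc, hIBP, hErr, hsub_int, hDm, hDn]
    ring
  -- size of the error
  have hDMm : ‖D m - M m‖ ≤ 2 * ε * m := by
    rw [hDm]; have := hDM m hnmR le_rfl; rwa [Nat.floor_natCast] at this
  have hDMn : ‖D n - M n‖ ≤ 2 * ε * n := by
    rw [hDn]; have := hDM n le_rfl hnmR; rwa [Nat.floor_natCast] at this
  have hwm : ‖((weight m : ℝ) : ℂ) * (D m - M m)‖ ≤ 2 * ε := by
    rw [norm_mul, Complex.norm_real, Real.norm_eq_abs, weight, abs_of_pos (by positivity)]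
    calc ((m : ℝ) * Real.log m)⁻¹ * ‖D m - M m‖
        ≤ ((m : ℝ) * Real.log m)⁻¹ * (2 * ε * m) := mul_le_mul_of_nonneg_left hDMm (by positivity)
      _ = 2 * ε / Real.log m := by field_simp
      _ ≤ 2 * ε / 1 := div_le_div_of_nonneg_left (by positivity) one_pos (hlogn1.trans hlogm)
      _ = 2 * ε := div_one _
  have hwn : ‖((weight n : ℝ) : ℂ) * (D n - M n)‖ ≤ 2 * ε := by
    rw [norm_mul, Complex.norm_real, Real.norm_eq_abs, weight, abs_of_pos (by positivity)]
    calc ((n : ℝ) * Real.log n)⁻¹ * ‖D n - M n‖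
        ≤ ((n : ℝ) * Real.log n)⁻¹ * (2 * ε * n) := mul_le_mul_of_nonneg_left hDMn (by positivity)
      _ = 2 * ε / Real.log n := by field_simp
      _ ≤ 2 * ε / 1 := div_le_div_of_nonneg_left (by positivity) one_pos hlogn1
      _ = 2 * ε := div_one _
  set g : ℝ → ℝ := fun u ↦ 4 * ε / Real.log n * u⁻¹ with hgdef
  have hgcont : ContinuousOn g (Set.Icc (n : ℝ) m) := by
    refine ContinuousOn.mul continuousOn_const (continuousOn_inv₀.comp continuousOn_id fun u hu ↦ ?_)
    exact (by linarith [hu.1] : (0 : ℝ) < u).ne'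
  have hgi : IntervalIntegrable g volume n m := by
    rw [intervalIntegrable_iff_integrableOn_Icc_of_le hnmR]; exact hgcont.integrableOn_Icc
  have hbound : ∀ᵐ u : ℝ ∂volume, u ∈ Set.Ioc (n : ℝ) m → ‖w' u * (D u - M u)‖ ≤ g u := by
    refine ae_of_all _ fun u hu ↦ ?_
    have hu1 : (n : ℝ) < u := hu.1
    have hu2 : u ≤ m := hu.2
    have hu0 : 0 < u := by linarith
    have hlogu : Real.log n ≤ Real.log u := Real.log_le_log hn0 hu1.le
    have hlogu1 : 1 ≤ Real.log u := hlogn1.trans hlogu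
    rw [norm_mul]
    have h1 := norm_deriv_weight_le (by linarith : 1 < u) hlogu1
    have h2 := hDM u hu1.le hu2
    calc ‖w' u‖ * ‖D u - M u‖ ≤ 2 / (u ^ 2 * Real.log u) * (2 * ε * u) :=
          mul_le_mul h1 h2 (norm_nonneg _) (by positivity)
      _ = 4 * ε / Real.log u * u⁻¹ := by field_simp; ring
      _ ≤ 4 * ε / Real.log n * u⁻¹ := by gcongr
      _ = g u := rfl
  have hint : ‖∫ u in (n : ℝ)..m, w' u * (D u - M u)‖ ≤ 4 * ε * ℓ := by
    refine (intervalIntegral.norm_integral_le_of_norm_le hnmR hbound hgi).trans ?_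
    rw [hgdef, intervalIntegral.integral_const_mul, integral_inv_of_pos hn0 hm0]
    calc 4 * ε / Real.log n * Real.log ((m : ℝ) / n) ≤ 4 * ε / Real.log n * ℓ :=
          mul_le_mul_of_nonneg_left hlogmn (by positivity)
      _ ≤ 4 * ε / 1 * ℓ := by gcongr
      _ = 4 * ε * ℓ := by rw [div_one]
  have hErr_le : ‖Err‖ ≤ 1 := by
    have h1 : ‖Err‖ ≤ 2 * ε + 2 * ε + 4 * ε * ℓ := by
      calc ‖Err‖ ≤ ‖((weight m : ℝ) : ℂ) * (D m - M m) - ((weight n : ℝ) : ℂ) * (D n - M n)‖ +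
            ‖∫ u in (n : ℝ)..m, w' u * (D u - M u)‖ := norm_sub_le _ _
        _ ≤ (‖((weight m : ℝ) : ℂ) * (D m - M m)‖ + ‖((weight n : ℝ) : ℂ) * (D n - M n)‖) +
            ‖∫ u in (n : ℝ)..m, w' u * (D u - M u)‖ := by gcongr; exact norm_sub_le _ _
        _ ≤ (2 * ε + 2 * ε) + 4 * ε * ℓ := add_le_add (add_le_add hwm hwn) hint
    -- `ε = ℓ^{-2}`, `ℓ ≥ 16`
    have h2 : 4 * ε + 4 * ε * ℓ ≤ 1 := by
      rw [hεval]
      have hℓ2 : 0 < ℓ ^ 2 := by positivity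
      rw [show 4 * (ℓ ^ 2)⁻¹ + 4 * (ℓ ^ 2)⁻¹ * ℓ = (4 + 4 * ℓ) / ℓ ^ 2 by field_simp,
        div_le_one hℓ2]
      nlinarith
    linarith
  -- the norm of the main term
  have hMain_le : ‖Main‖ ≤ 3 := by
    have hen : Real.exp 1 ≤ (n : ℝ) := by
      have h := Real.exp_le_exp.2 hlogn1
      rwa [Real.exp_log hn0] at h
    by_cases hχ : χ = 1
    · have hδ : delta χ = 1 := by simp [delta, hχ]
      have e : Main = ∫ u in (n : ℝ)..m, ((weight u : ℝ) : ℂ) * (u : ℂ) ^ (-((t : ℂ) * I)) := by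
        simp only [hMain, hM'def, hδ, one_mul, hrdef]
      rw [e]
      exact norm_integral_weight_mul_cpow_le ht1 hen hnmR
    · have hδ : delta χ = 0 := by simp [delta, hχ]
      have e : Main = 0 := by
        simp only [hMain, hM'def, hδ, zero_mul, mul_zero, intervalIntegral.integral_zero]
      rw [e, norm_zero]; norm_num
  -- conclusion
  rw [hdecomp]
  calc ‖Main + Err‖ ≤ ‖Main‖ + ‖Err‖ := norm_add_le _ _
    _ ≤ 3 + 1 := add_le_add hMain_le hErr_le
    _ = 4 := by norm_num

/-- **The prime character sums over the Vinogradov–Korobov window are bounded, for `|t| ≥ 1`.**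
Assume Khale's theorem.  For `A > 0`, `θ > 2/3`: for all large `X`, all `q ≤ (log X)^A`, all `χ` mod
`q`, all `1 ≤ |t| ≤ X` and all `Y ≤ X`,
`‖∑_{exp((log X)^θ) ≤ p ≤ Y} χ(p) p^{-1-it}‖ ≤ 4`.
This is the quantitative content of "by the zero-free region for the Riemann zeta-function,
`|∑_{exp((log x)^{2/3+ε}) ≤ p ≤ x} p^{-1-2iα}| = O(1)` for `1 ≤ |α| ≤ x^A`" in the proof of
Matomäki–Radziwiłł 2016, Lemma 2 (here for `|t| ≤ X`, with characters, and uniformly in the upper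
limit `Y ≤ X`).  Proof: word for word that of `MRT2015DistLowerBound.re_primeCharSum_ge` (Abel summation
with `f(u) = 1/(u log u)` against `D(u) = ∑_{p ≤ u} χ(p) log p · p^{-it} = δ_χ u^{1-it}/(1-it) + O(u(log X)^{-2})`,
`TwistedVonMangoldt.twisted_sum_estimate`, error terms `≤ 1` in norm), except that the main term
`δ_χ ∫ u^{-it} du/(u log u)` is now bounded in norm by `3` for `|t| ≥ 1`
(`norm_integral_weight_mul_cpow_le`) instead of in real part from below.
[cite: MatomakiRadziwillAnnals2016, Lemma 2 (proof)] [cite: Khale2024, Theorem 1.1] -/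
theorem norm_primeCharSum_le (hK : Khale2024_zeroFreeRegion) {A θ : ℝ} (hA : 0 < A)
    (hθ : 2 / 3 < θ) :
    ∀ᶠ X : ℝ in atTop, ∀ (q : ℕ) [NeZero q], (q : ℝ) ≤ Real.log X ^ A →
      ∀ (χ : DirichletCharacter ℂ q) (t : ℝ), 1 ≤ |t| → |t| ≤ X → ∀ Y : ℝ, Y ≤ X →
        ‖∑ p ∈ (Finset.Icc ⌈Real.exp (Real.log X ^ θ)⌉₊ ⌊Y⌋₊).filter Nat.Prime,
            χ (p : ZMod q) * (p : ℂ) ^ (-(1 + (t : ℂ) * I))‖ ≤ 4  :=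
  norm_primeCharSum_le_of_vk (by norm_num) (hasVKZeroFreeRegion_of_khale hK) hA hθ

/-! ### The tail of the twist distance `𝔻(1, n^{it})²` over the Vinogradov–Korobov window -/

/-- The trivial character mod `1` is identically `1`. [folklore] -/
theorem dirichletCharacter_one_mod_one_apply (x : ZMod 1) : (1 : DirichletCharacter ℂ 1) x = 1 :=
  MulChar.one_apply (isUnit_of_subsingleton x)

set_option maxHeartbeats 800000 in
/-- (From any Vinogradov–Korobov region `HasVKZeroFreeRegion cVK TVK`, `cVK > 0`.)  **Matomäki–Radziwiłł's Lemma 2, localised to the Vinogradov–Korobov window, for twists.**  Assume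
Khale's theorem and let `θ > 2/3`.  For all large `X`, all `1 ≤ |t| ≤ X` and all
`exp((log X)^θ) ≤ Y ≤ X`,
`∑_{exp((log X)^θ) ≤ p ≤ Y} (1 - Re p^{it})/p ≥ log log Y - θ log log X - 6`:
Mertens (`MertensBound.loglog_sub_loglog_le_sum_inv_prime_Icc`: `∑ 1/p ≥ log log Y - log log P - 6/log P`,
`log log P = θ log log X`, `6/log P ≤ 3/2`) and `|Re ∑ p^{-1+it}| ≤ 4` (`norm_primeCharSum_le` with the
trivial character mod `1`).  With `Y = X` and `θ = 2/3 + ε` this is the printed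
`𝔻(1, p^{iα}; x)² ≥ ∑_{exp((log x)^{2/3+ε}) ≤ p ≤ x} (1 - Re p^{-iα})/p ≥ (1/3 - ε) log log x + O(1)`.
[cite: MatomakiRadziwillAnnals2016, Lemma 2 (proof)] [cite: Khale2024, Theorem 1.1] -/
theorem sum_one_sub_re_twist_ge_of_vk {cVK TVK : ℝ} (hcVK : 0 < cVK) (hVK : HasVKZeroFreeRegion cVK TVK) {θ : ℝ} (hθ : 2 / 3 < θ) :
    ∀ᶠ X : ℝ in atTop, ∀ t : ℝ, 1 ≤ |t| → |t| ≤ X → ∀ Y : ℝ, Real.exp (Real.log X ^ θ) ≤ Y → Y ≤ X →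
      Real.log (Real.log Y) - θ * Real.log (Real.log X) - 6 ≤
        ∑ p ∈ (Finset.Icc ⌈Real.exp (Real.log X ^ θ)⌉₊ ⌊Y⌋₊).filter Nat.Prime,
          (1 - ((p : ℂ) ^ ((t : ℂ) * I)).re) / p := by
  have hθ0 : 0 < θ := by linarith
  filter_upwards [norm_primeCharSum_le_of_vk hcVK hVK (A := 1) one_pos hθ,
    Real.tendsto_log_atTop.eventually_ge_atTop (1 : ℝ),
    ((tendsto_rpow_atTop hθ0).comp Real.tendsto_log_atTop).eventually_ge_atTop (4 : ℝ)] with X hS hℓ1 hℓθ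
  intro t ht1 ht Y hPY hYX
  set ℓ : ℝ := Real.log X with hℓdef
  have hℓ0 : 0 < ℓ := by linarith
  have hℓθ' : (4 : ℝ) ≤ ℓ ^ θ := by simpa using hℓθ
  set P : ℝ := Real.exp (ℓ ^ θ) with hPdef
  have hP0 : 0 < P := Real.exp_pos _
  have hlogP : Real.log P = ℓ ^ θ := Real.log_exp _
  have hP2 : (2 : ℝ) ≤ P := by
    have h4 : Real.exp 4 ≤ P := Real.exp_le_exp.2 hℓθ'
    have : (5 : ℝ) ≤ Real.exp 4 := by have := Real.add_one_le_exp (4 : ℝ); linarith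
    linarith
  -- Mertens
  have hM := MertensBound.loglog_sub_loglog_le_sum_inv_prime_Icc hP2 hPY
  have hloglogP : Real.log (Real.log P) = θ * Real.log ℓ := by
    rw [hlogP, Real.log_rpow hℓ0]
  have h6 : 6 / Real.log P ≤ 2 := by
    rw [hlogP, div_le_iff₀ (by linarith)]; linarith
  -- the oscillating part, with the trivial character mod `1` and `t ↦ -t`
  have hq : ((1 : ℕ) : ℝ) ≤ Real.log X ^ (1 : ℝ) := by simpa using hℓ1
  have hS' := hS 1 hq (1 : DirichletCharacter ℂ 1) (-t) (by simpa using ht1) (by simpa using ht) Y hYX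
  set S : ℂ := ∑ p ∈ (Finset.Icc ⌈P⌉₊ ⌊Y⌋₊).filter Nat.Prime,
    (1 : DirichletCharacter ℂ 1) (p : ZMod 1) * (p : ℂ) ^ (-(1 + ((-t : ℝ) : ℂ) * I)) with hSdef
  have hSre : S.re = ∑ p ∈ (Finset.Icc ⌈P⌉₊ ⌊Y⌋₊).filter Nat.Prime, (1 : ℝ) / p * ((p : ℂ) ^ ((t : ℂ) * I)).re := by
    rw [hSdef, Complex.re_sum]
    refine Finset.sum_congr rfl fun p hp => ?_
    have hpp : p.Prime := (Finset.mem_filter.1 hp).2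
    rw [re_term_eq (1 : DirichletCharacter ℂ 1) t hpp, dirichletCharacter_one_mod_one_apply, one_mul]
  have hSre_le : S.re ≤ 4 := (Complex.re_le_norm S).trans hS'
  -- assemble
  have hsplit : ∑ p ∈ (Finset.Icc ⌈P⌉₊ ⌊Y⌋₊).filter Nat.Prime, (1 - ((p : ℂ) ^ ((t : ℂ) * I)).re) / p =
      (∑ p ∈ (Finset.Icc ⌈P⌉₊ ⌊Y⌋₊).filter Nat.Prime, (1 : ℝ) / p) - S.re := by
    rw [hSre, ← Finset.sum_sub_distrib]
    refine Finset.sum_congr rfl fun p _ => ?_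
    ring
  rw [hsplit]
  linarith

/-- **Matomäki–Radziwiłł's Lemma 2, localised to the Vinogradov–Korobov window, for twists.**  Assume
Khale's theorem and let `θ > 2/3`.  For all large `X`, all `1 ≤ |t| ≤ X` and all
`exp((log X)^θ) ≤ Y ≤ X`,
`∑_{exp((log X)^θ) ≤ p ≤ Y} (1 - Re p^{it})/p ≥ log log Y - θ log log X - 6`:
Mertens (`MertensBound.loglog_sub_loglog_le_sum_inv_prime_Icc`: `∑ 1/p ≥ log log Y - log log P - 6/log P`,
`log log P = θ log log X`, `6/log P ≤ 3/2`) and `|Re ∑ p^{-1+it}| ≤ 4` (`norm_primeCharSum_le` with the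
trivial character mod `1`).  With `Y = X` and `θ = 2/3 + ε` this is the printed
`𝔻(1, p^{iα}; x)² ≥ ∑_{exp((log x)^{2/3+ε}) ≤ p ≤ x} (1 - Re p^{-iα})/p ≥ (1/3 - ε) log log x + O(1)`.
[cite: MatomakiRadziwillAnnals2016, Lemma 2 (proof)] [cite: Khale2024, Theorem 1.1] -/
theorem sum_one_sub_re_twist_ge (hK : Khale2024_zeroFreeRegion) {θ : ℝ} (hθ : 2 / 3 < θ) :
    ∀ᶠ X : ℝ in atTop, ∀ t : ℝ, 1 ≤ |t| → |t| ≤ X → ∀ Y : ℝ, Real.exp (Real.log X ^ θ) ≤ Y → Y ≤ X →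
      Real.log (Real.log Y) - θ * Real.log (Real.log X) - 6 ≤
        ∑ p ∈ (Finset.Icc ⌈Real.exp (Real.log X ^ θ)⌉₊ ⌊Y⌋₊).filter Nat.Prime,
          (1 - ((p : ℂ) ^ ((t : ℂ) * I)).re) / p  :=
  sum_one_sub_re_twist_ge_of_vk (by norm_num) (hasVKZeroFreeRegion_of_khale hK) hθ

open Literature.NumberTheory.Sieve (pretentiousDistSq minPretentiousDistSq) in
/-- (From any Vinogradov–Korobov region `HasVKZeroFreeRegion cVK TVK`, `cVK > 0`.)  The same in terms of the pretentious distance of the tree: for large `X`, `1 ≤ |t| ≤ X`,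
`exp((log X)^θ) ≤ Y ≤ X`,
`log log Y - θ log log X - 6 ≤ 𝔻(1, n^{it}; Y)² - 𝔻(1, n^{it}; exp((log X)^θ) - 1)²`
(the right side is the sum of `(1 - Re p^{it})/p` over the primes `exp((log X)^θ) - 1 < p ≤ Y`, which
contains the window of `sum_one_sub_re_twist_ge`; all terms are `≥ 0`).  This is the input `y = exp((log X)^θ) - 1`
of `Halasz.Restricted.offDist_ge_tail` / `halfDistSq_ge_quarter_tail_of_le_min`.
[cite: MatomakiRadziwillAnnals2016, Lemma 2 (proof)] [cite: Khale2024, Theorem 1.1] -/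
theorem pretentiousDistSq_one_twist_tail_ge_of_vk {cVK TVK : ℝ} (hcVK : 0 < cVK) (hVK : HasVKZeroFreeRegion cVK TVK) {θ : ℝ} (hθ : 2 / 3 < θ) :
    ∀ᶠ X : ℝ in atTop, ∀ t : ℝ, 1 ≤ |t| → |t| ≤ X → ∀ Y : ℝ, Real.exp (Real.log X ^ θ) ≤ Y → Y ≤ X →
      Real.log (Real.log Y) - θ * Real.log (Real.log X) - 6 ≤
        pretentiousDistSq 1 (fun n : ℕ => (n : ℂ) ^ ((t : ℂ) * I)) Y -
          pretentiousDistSq 1 (fun n : ℕ => (n : ℂ) ^ ((t : ℂ) * I)) (Real.exp (Real.log X ^ θ) - 1) := by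
  filter_upwards [sum_one_sub_re_twist_ge_of_vk hcVK hVK hθ, Real.tendsto_log_atTop.eventually_ge_atTop (0 : ℝ)]
    with X hX hℓ0
  intro t ht1 ht Y hPY hYX
  refine (hX t ht1 ht Y hPY hYX).trans ?_
  set P : ℝ := Real.exp (Real.log X ^ θ) with hPdef
  have hP1 : 1 ≤ P := by
    have : (1 : ℝ) ≤ Real.exp 0 := by rw [Real.exp_zero]
    exact this.trans (Real.exp_le_exp.2 (Real.rpow_nonneg hℓ0 θ))
  have hP10 : 0 ≤ P - 1 := by linarith
  set f : ℕ → ℝ := fun p => (1 - ((p : ℂ) ^ ((t : ℂ) * I)).re) / p with hf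
  have hτ : ∀ n : ℕ, ‖(n : ℂ) ^ (((t : ℝ) : ℂ) * I)‖ ≤ 1 :=
    Halasz.Restricted.norm_natCast_cpow_le_one_of_re_eq_zero (by simp)
  have h1b : ∀ n : ℕ, ‖(1 : ℕ → ℂ) n‖ ≤ 1 := fun n => by simp
  have hf0 : ∀ p : ℕ, 0 ≤ f p := fun p => by
    have h := Sieve.pretentiousDistSq_summand_nonneg h1b hτ p
    simpa only [Pi.one_apply, one_mul, Complex.conj_re] using h
  have hsum : ∀ z : ℝ, pretentiousDistSq 1 (fun n : ℕ => (n : ℂ) ^ ((t : ℂ) * I)) z =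
      ∑ p ∈ Nat.primesLE ⌊z⌋₊, f p := fun z => by
    unfold pretentiousDistSq
    refine Finset.sum_congr rfl fun p _ => ?_
    simp only [Pi.one_apply, one_mul, Complex.conj_re, hf]
  rw [hsum, hsum]
  have hsub : Nat.primesLE ⌊P - 1⌋₊ ⊆ Nat.primesLE ⌊Y⌋₊ := by
    intro p hp
    rw [Nat.mem_primesLE] at hp ⊢
    exact ⟨hp.1.trans (Nat.floor_le_floor (by linarith)), hp.2⟩
  rw [← Finset.sum_sdiff hsub, add_sub_cancel_right]
  refine Finset.sum_le_sum_of_subset_of_nonneg (fun p hp => ?_) (fun p _ _ => hf0 p)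
  rw [Finset.mem_filter, Finset.mem_Icc] at hp
  rw [Finset.mem_sdiff, Nat.mem_primesLE, Nat.mem_primesLE]
  refine ⟨⟨hp.1.2, hp.2⟩, fun h => ?_⟩
  have h1 : (p : ℝ) ≤ P - 1 := (Nat.le_floor_iff hP10).1 h.1
  have h2 : P ≤ p := Nat.ceil_le.1 hp.1.1
  linarith

open Literature.NumberTheory.Sieve (pretentiousDistSq minPretentiousDistSq) in
/-- The same in terms of the pretentious distance of the tree: for large `X`, `1 ≤ |t| ≤ X`,
`exp((log X)^θ) ≤ Y ≤ X`,
`log log Y - θ log log X - 6 ≤ 𝔻(1, n^{it}; Y)² - 𝔻(1, n^{it}; exp((log X)^θ) - 1)²`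
(the right side is the sum of `(1 - Re p^{it})/p` over the primes `exp((log X)^θ) - 1 < p ≤ Y`, which
contains the window of `sum_one_sub_re_twist_ge`; all terms are `≥ 0`).  This is the input `y = exp((log X)^θ) - 1`
of `Halasz.Restricted.offDist_ge_tail` / `halfDistSq_ge_quarter_tail_of_le_min`.
[cite: MatomakiRadziwillAnnals2016, Lemma 2 (proof)] [cite: Khale2024, Theorem 1.1] -/
theorem pretentiousDistSq_one_twist_tail_ge (hK : Khale2024_zeroFreeRegion) {θ : ℝ} (hθ : 2 / 3 < θ) :
    ∀ᶠ X : ℝ in atTop, ∀ t : ℝ, 1 ≤ |t| → |t| ≤ X → ∀ Y : ℝ, Real.exp (Real.log X ^ θ) ≤ Y → Y ≤ X →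
      Real.log (Real.log Y) - θ * Real.log (Real.log X) - 6 ≤
        pretentiousDistSq 1 (fun n : ℕ => (n : ℂ) ^ ((t : ℂ) * I)) Y -
          pretentiousDistSq 1 (fun n : ℕ => (n : ℂ) ^ ((t : ℂ) * I)) (Real.exp (Real.log X ^ θ) - 1)  :=
  pretentiousDistSq_one_twist_tail_ge_of_vk (by norm_num) (hasVKZeroFreeRegion_of_khale hK) hθ

/-! ### The region `𝒯₂`: the halved distance of restricted Halász is `≥ (1/12 - ε) log log X - O(1)` -/

open Literature.NumberTheory.Sieve (pretentiousDistSq minPretentiousDistSq) in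
/-- (From any Vinogradov–Korobov region `HasVKZeroFreeRegion cVK TVK`, `cVK > 0`.)  **Lower bound for the halved distance away from the minimiser (complex `f`, restricted sums).**
Assume Khale's theorem and let `θ > 2/3`.  For all large `X`: for every `g` with `|g| ≤ 1`, every
finite set `E` of "block" primes `≤ exp((log X)^θ) - 1`, all `exp((log X)^θ) ≤ x ≤ X`, `|t| ≤ T`, every
`δ`-near-minimiser `t₁` of `M(x, T) = min_{|u| ≤ T} 𝔻(g, n^{iu}; x)²` with `1 ≤ |t - t₁| ≤ X`,
`(log log x - θ log log X - 6)/4 - δ/2 ≤ 𝔻_½(g, n^{it}; x)²`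
(`Halasz.Restricted.halfDistSq`, the distance of `Halasz.Restricted.norm_restr_sum_le`).  This is
`Halasz.Restricted.halfDistSq_ge_quarter_tail_of_le_min` fed with `pretentiousDistSq_one_twist_tail_ge`
at `t - t₁`: in Matomäki–Radziwiłł–Tao 2015, Prop. A.3, with `X` the scale `2x` (so that
`|t - t₁| ≤ 2x` is allowed) and `θ = 2/3 + ε`, it gives `𝔻_½(f, p^{it}; x)² ≥ (1/12 - ε) log log x - O(1)`
on `𝒯₂ = {|t - t₁| ≥ (log x)^{1/16}}` for the block-RESTRICTED sums — the same constant as the printed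
`2𝔻(f, p^{it}; X) ≥ 𝔻(1, p^{i(t-t₁)}) ≥ (1/√3 - ε) √(log log X)` for unrestricted ones.
[cite: MatomakiRadziwillTao2015, Appendix A, Proposition A.3 (proof)] [cite: Khale2024, Theorem 1.1] -/
theorem halfDistSq_ge_of_far_from_minimiser_of_vk {cVK TVK : ℝ} (hcVK : 0 < cVK) (hVK : HasVKZeroFreeRegion cVK TVK) {θ : ℝ} (hθ : 2 / 3 < θ) :
    ∀ᶠ X : ℝ in atTop, ∀ (g : ℕ → ℂ), (∀ n, ‖g n‖ ≤ 1) → ∀ (E : Finset ℕ),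
      (∀ p ∈ E, (p : ℝ) ≤ Real.exp (Real.log X ^ θ) - 1) →
      ∀ (x T t t₁ δ : ℝ), Real.exp (Real.log X ^ θ) ≤ x → x ≤ X → |t| ≤ T →
        pretentiousDistSq g (fun n : ℕ => (n : ℂ) ^ ((t₁ : ℂ) * I)) x ≤ minPretentiousDistSq g x T + δ →
        1 ≤ |t - t₁| → |t - t₁| ≤ X →
        (Real.log (Real.log x) - θ * Real.log (Real.log X) - 6) / 4 - δ / 2 ≤
          Halasz.Restricted.halfDistSq E g t x := by
  filter_upwards [pretentiousDistSq_one_twist_tail_ge_of_vk hcVK hVK hθ] with X hX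
  intro g hgb E hE x T t t₁ δ hPx hxX ht hmin h1 h2
  have htail := hX (t - t₁) h1 h2 x hPx hxX
  have hmain := Halasz.Restricted.halfDistSq_ge_quarter_tail_of_le_min hgb hE ht hmin
    (y := Real.exp (Real.log X ^ θ) - 1) (t₁ := t₁)
  linarith

open Literature.NumberTheory.Sieve (pretentiousDistSq minPretentiousDistSq) in
/-- **Lower bound for the halved distance away from the minimiser (complex `f`, restricted sums).**
Assume Khale's theorem and let `θ > 2/3`.  For all large `X`: for every `g` with `|g| ≤ 1`, every
finite set `E` of "block" primes `≤ exp((log X)^θ) - 1`, all `exp((log X)^θ) ≤ x ≤ X`, `|t| ≤ T`, every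
`δ`-near-minimiser `t₁` of `M(x, T) = min_{|u| ≤ T} 𝔻(g, n^{iu}; x)²` with `1 ≤ |t - t₁| ≤ X`,
`(log log x - θ log log X - 6)/4 - δ/2 ≤ 𝔻_½(g, n^{it}; x)²`
(`Halasz.Restricted.halfDistSq`, the distance of `Halasz.Restricted.norm_restr_sum_le`).  This is
`Halasz.Restricted.halfDistSq_ge_quarter_tail_of_le_min` fed with `pretentiousDistSq_one_twist_tail_ge`
at `t - t₁`: in Matomäki–Radziwiłł–Tao 2015, Prop. A.3, with `X` the scale `2x` (so that
`|t - t₁| ≤ 2x` is allowed) and `θ = 2/3 + ε`, it gives `𝔻_½(f, p^{it}; x)² ≥ (1/12 - ε) log log x - O(1)`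
on `𝒯₂ = {|t - t₁| ≥ (log x)^{1/16}}` for the block-RESTRICTED sums — the same constant as the printed
`2𝔻(f, p^{it}; X) ≥ 𝔻(1, p^{i(t-t₁)}) ≥ (1/√3 - ε) √(log log X)` for unrestricted ones.
[cite: MatomakiRadziwillTao2015, Appendix A, Proposition A.3 (proof)] [cite: Khale2024, Theorem 1.1] -/
theorem halfDistSq_ge_of_far_from_minimiser (hK : Khale2024_zeroFreeRegion) {θ : ℝ} (hθ : 2 / 3 < θ) :
    ∀ᶠ X : ℝ in atTop, ∀ (g : ℕ → ℂ), (∀ n, ‖g n‖ ≤ 1) → ∀ (E : Finset ℕ),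
      (∀ p ∈ E, (p : ℝ) ≤ Real.exp (Real.log X ^ θ) - 1) →
      ∀ (x T t t₁ δ : ℝ), Real.exp (Real.log X ^ θ) ≤ x → x ≤ X → |t| ≤ T →
        pretentiousDistSq g (fun n : ℕ => (n : ℂ) ^ ((t₁ : ℂ) * I)) x ≤ minPretentiousDistSq g x T + δ →
        1 ≤ |t - t₁| → |t - t₁| ≤ X →
        (Real.log (Real.log x) - θ * Real.log (Real.log X) - 6) / 4 - δ / 2 ≤
          Halasz.Restricted.halfDistSq E g t x  :=
  halfDistSq_ge_of_far_from_minimiser_of_vk (by norm_num) (hasVKZeroFreeRegion_of_khale hK) hθ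

open Literature.NumberTheory.Sieve (pretentiousDistSq minPretentiousDistSq) in
/-- (From any Vinogradov–Korobov region `HasVKZeroFreeRegion cVK TVK`, `cVK > 0`.)  The same with the scale `X = 2x` built in: for all large `x`, `|g| ≤ 1`, blocks
`≤ exp((log 2x)^θ) - 1`, `|t| ≤ T`, `t₁` a `δ`-near-minimiser of `M(x, T)` and `1 ≤ |t - t₁| ≤ 2x`,
`(log log x - θ log log (2x) - 6)/4 - δ/2 ≤ 𝔻_½(g, n^{it}; x)²`. [cite: MatomakiRadziwillTao2015, Appendix A, Proposition A.3 (proof)] -/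
theorem halfDistSq_ge_of_far_from_minimiser_two_mul_of_vk {cVK TVK : ℝ} (hcVK : 0 < cVK) (hVK : HasVKZeroFreeRegion cVK TVK) {θ : ℝ}
    (hθ : 2 / 3 < θ) :
    ∀ᶠ x : ℝ in atTop, ∀ (g : ℕ → ℂ), (∀ n, ‖g n‖ ≤ 1) → ∀ (E : Finset ℕ),
      (∀ p ∈ E, (p : ℝ) ≤ Real.exp (Real.log (2 * x) ^ θ) - 1) →
      ∀ (T t t₁ δ : ℝ), Real.exp (Real.log (2 * x) ^ θ) ≤ x → |t| ≤ T →
        pretentiousDistSq g (fun n : ℕ => (n : ℂ) ^ ((t₁ : ℂ) * I)) x ≤ minPretentiousDistSq g x T + δ →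
        1 ≤ |t - t₁| → |t - t₁| ≤ 2 * x →
        (Real.log (Real.log x) - θ * Real.log (Real.log (2 * x)) - 6) / 4 - δ / 2 ≤
          Halasz.Restricted.halfDistSq E g t x := by
  have h2 : Tendsto (fun x : ℝ => 2 * x) atTop atTop := tendsto_id.const_mul_atTop (by norm_num)
  filter_upwards [h2.eventually (halfDistSq_ge_of_far_from_minimiser_of_vk hcVK hVK hθ),
    eventually_ge_atTop (0 : ℝ)] with x hx hx0
  intro g hgb E hE T t t₁ δ hPx ht hmin h1 h2'
  exact hx g hgb E hE x T t t₁ δ hPx (by linarith) ht hmin h1 h2'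

open Literature.NumberTheory.Sieve (pretentiousDistSq minPretentiousDistSq) in
/-- The same with the scale `X = 2x` built in: for all large `x`, `|g| ≤ 1`, blocks
`≤ exp((log 2x)^θ) - 1`, `|t| ≤ T`, `t₁` a `δ`-near-minimiser of `M(x, T)` and `1 ≤ |t - t₁| ≤ 2x`,
`(log log x - θ log log (2x) - 6)/4 - δ/2 ≤ 𝔻_½(g, n^{it}; x)²`. [cite: MatomakiRadziwillTao2015, Appendix A, Proposition A.3 (proof)] -/
theorem halfDistSq_ge_of_far_from_minimiser_two_mul (hK : Khale2024_zeroFreeRegion) {θ : ℝ}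
    (hθ : 2 / 3 < θ) :
    ∀ᶠ x : ℝ in atTop, ∀ (g : ℕ → ℂ), (∀ n, ‖g n‖ ≤ 1) → ∀ (E : Finset ℕ),
      (∀ p ∈ E, (p : ℝ) ≤ Real.exp (Real.log (2 * x) ^ θ) - 1) →
      ∀ (T t t₁ δ : ℝ), Real.exp (Real.log (2 * x) ^ θ) ≤ x → |t| ≤ T →
        pretentiousDistSq g (fun n : ℕ => (n : ℂ) ^ ((t₁ : ℂ) * I)) x ≤ minPretentiousDistSq g x T + δ →
        1 ≤ |t - t₁| → |t - t₁| ≤ 2 * x →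
        (Real.log (Real.log x) - θ * Real.log (Real.log (2 * x)) - 6) / 4 - δ / 2 ≤
          Halasz.Restricted.halfDistSq E g t x  :=
  halfDistSq_ge_of_far_from_minimiser_two_mul_of_vk (by norm_num) (hasVKZeroFreeRegion_of_khale hK) hθ

end TwistedPrimeSumTail

end Literature.NumberTheory.LFunctions

end
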